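import Summits.QuantumAdvantage.QuantumAdvantage.Theorems.LinnikCubicClassGroupsPureCubicClassGroupFBQPOfLowerPIT
import Summits.QuantumAdvantage.QuantumAdvantage.Theorems.LinnikCubicClassGroupsDegreeOnePrimesEscapeLowerPIT
import HarnessLib

/-!
# UNCONDITIONAL: the low bits of the class number of a pure cubic field are an FBQP function
# (no GRH, no Siegel hypothesis, standard axioms)

Topic `Summits/QuantumAdvantage/QuantumAdvantage/Theorems`, route `LinnikCubicClassGroups`; helper for the crux
`DegreeOnePrimesEscape` (stmt-QuantumAdvantage-11543) — its `n = 3` slice `CubicEscape` is PROVED here — and the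
hypothesis-free form of the proved crux `PureCubicClassGroupFBQP` (stmt-QuantumAdvantage-11544). Cell B2b-1 (linnik-cubic),
PART B (final glue; PART A = the log-free zero density for `ζ₁_K` at degree `3` and the lower prime ideal theorem T5).
HONEST FRAMING: the value of this file is a THEOREM — NOT summit progress (the summit needs the hypothesis-type target
`PureCubicClassNumberHard`, untouched).

* `cubicEscape` — **the Linnik–Stark escape count for cubic fields**: there is `C` such that for every cubic number field
  `K` (no quadratic subfield — automatic), every `x ≥ |d_K|^C` and every proper subgroup `M` of `Cl(𝓞 K)`, at least `π(x)/8`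
  prime ideals of `K` of prime norm `≤ x` have class outside `M`. Inputs, all theorems of the tree: Stark's zero-free
  interval (S), the residue bound `κ_K ≥ Q^{−10}` (R, Stark 1974 Lemma 4), the one-sided per-character deficit from the
  log-free zero density of class-group twists (T4, `n ≤ 4`), and the lower prime ideal theorem dichotomy from the log-free
  zero density of `ζ₁_K` at degree `3` (T5, `lowerPITκ_three`); composition `cubicEscape_of_lowerPIT`.
* `pureCubicClassNumber_lowBits_mem_FBQP` — **the conclusion of `PureCubicClassGroupFBQP` with its hypothesis
  `DegreeOnePrimesEscape` removed**: some `f ∈ FBQP` with `|f x| = 2|x|+8` outputs, for every `x` with `m = decodeNat x`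
  not a cube and every cubic `K ∋ ∛m`, the low `2|x|+8` bits of `h(K)` (`fbqp_of_lowerPIT`).

## References

* S. Hallgren, *Fast quantum algorithms for computing the unit group and class group of a number field*, STOC 2005
  (GRH only for the generating set). [Hallgren2005]
* J.-F. Biasse, F. Song, SODA 2016, Thm 1.2 (class group under GRH, via Bach's bound). [BiasseSong2015]
* J. Thorner, A. Zaman, *A unified and improved Chebotarev density theorem*, ANT 13 (2019), Thm 3.2. [ThornerZaman2019]
* H. M. Stark, *Some effective cases of the Brauer–Siegel theorem*, Invent. Math. 23 (1974), Lemmas 3–4, Thm 3. [Stark1974]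
-/

noncomputable section

namespace Summit.QuantumAdvantage.QuantumAdvantage.Theorems.LinnikCubicClassGroups

open scoped NumberField nonZeroDivisors
open NumberField
open Summit.QuantumAdvantage.QuantumAdvantage.Theorems.DegreeOnePrimesEscape

/-- **`CubicEscape`, unconditionally** (the `n = 3` slice of the crux `DegreeOnePrimesEscape`): there is `C : ℕ` such
that for every cubic number field `K` without quadratic subfield, every `x ≥ |d_K|^C` and every proper subgroup `M` of the
class group, `π(x) ≤ 8 · #{P prime of 𝓞 K : N(P) prime, N(P) ≤ x, [P] ∉ M}`. Proof: `cubicEscape_of_lowerPIT` (R, T4, S and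
the subgroup-orthogonality composition) applied to PART A's lower prime ideal theorem dichotomy `lowerPITκ_three` at `A = 10`. -/
theorem cubicEscape :
    ∃ C : ℕ, ∀ (K : Type) [Field K] [NumberField K], Module.finrank ℚ K = 3 →
      (∀ F : IntermediateField ℚ K, Module.finrank ℚ F ≠ 2) → ∀ x : ℕ, |NumberField.discr K| ^ C ≤ (x : ℤ) →
      ∀ M : Subgroup (ClassGroup (NumberField.RingOfIntegers K)), M ≠ ⊤ →
        Nat.primeCounting x ≤ 8 * Set.ncard {P : Ideal (NumberField.RingOfIntegers K) | P.IsPrime ∧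
          (Ideal.absNorm P).Prime ∧ Ideal.absNorm P ≤ x ∧
          ∃ hP : P ∈ nonZeroDivisors (Ideal (NumberField.RingOfIntegers K)), ClassGroup.mk0 ⟨P, hP⟩ ∉ M} :=
  cubicEscape_of_lowerPIT (lowerPITκ_three 10)

/-- **UNCONDITIONAL FBQP THEOREM for pure cubic class numbers** (no GRH, no Siegel hypothesis): there is
`f ∈ FBQP` with `|f x| = 2|x|+8` such that for every bit string `x` whose number `m = decodeNat x` is not a perfect cube and
every cubic number field `K` containing a cube root of `m` (all `≅ ℚ(∛m)`), `f x` lists the low `2|x|+8` bits of the class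
number `h(K)`. This is the conclusion of the route decl `PureCubicClassGroupFBQP` with its hypothesis `DegreeOnePrimesEscape`
discharged at the only degree it is used (`n = 3`, `cubicEscape`). -/
theorem pureCubicClassNumber_lowBits_mem_FBQP :
    ∃ f : List Bool → List Bool, f ∈ Literature.Computability.Cryptography.FBQP ∧
      (∀ x, (f x).length = 2 * x.length + 8) ∧
      ∀ (x : List Bool) (K : Type) [Field K] [NumberField K], Module.finrank ℚ K = 3 →
        (∀ r : ℕ, r ^ 3 ≠ Computability.decodeNat x) → (∃ α : K, α ^ 3 = (Computability.decodeNat x : K)) →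
        f x = List.ofFn (fun i : Fin (2 * x.length + 8) => (NumberField.classNumber K).testBit i.val) :=
  fbqp_of_cubicEscape cubicEscape

/-- **`CubicEscape` for EVERY cubic number field** (appended 2026-08-20): the no-quadratic-subfield clause of `cubicEscape`
is vacuous in degree `3` (tower law: a subfield of a cubic field has degree `1` or `3`), so there is `C : ℕ` such that for
every cubic number field `K` (either signature), every `x ≥ |d_K|^C` and every proper subgroup `M` of the class group,
`π(x) ≤ 8 · #{P prime of 𝓞 K : N(P) prime, N(P) ≤ x, [P] ∉ M}` — GRH-free and Siegel-free. This is the exact analytic input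
(support `CubicEscape`) of the proposed successor route `AllCubicClassGroups` (class numbers of ALL cubic fields in `FBQP`). -/
theorem cubicEscape_all :
    ∃ C : ℕ, ∀ (K : Type) [Field K] [NumberField K], Module.finrank ℚ K = 3 →
      ∀ x : ℕ, |NumberField.discr K| ^ C ≤ (x : ℤ) →
      ∀ M : Subgroup (ClassGroup (NumberField.RingOfIntegers K)), M ≠ ⊤ →
        Nat.primeCounting x ≤ 8 * Set.ncard {P : Ideal (NumberField.RingOfIntegers K) | P.IsPrime ∧
          (Ideal.absNorm P).Prime ∧ Ideal.absNorm P ≤ x ∧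
          ∃ hP : P ∈ nonZeroDivisors (Ideal (NumberField.RingOfIntegers K)), ClassGroup.mk0 ⟨P, hP⟩ ∉ M} := by
  obtain ⟨C, hC⟩ := cubicEscape
  refine ⟨C, fun K _ _ hK x hx M hM => hC K hK (fun F hF => ?_) x hx M hM⟩
  have hdvd : Module.finrank ℚ F ∣ Module.finrank ℚ K := Dvd.intro _ (Module.finrank_mul_finrank ℚ F K)
  rw [hF, hK] at hdvd
  omega

end Summit.QuantumAdvantage.QuantumAdvantage.Theorems.LinnikCubicClassGroups

end
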